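import Mathlib.Algebra.DirectSum.Module
import Mathlib.LinearAlgebra.Dimension.Finrank
import Mathlib.Algebra.Ring.NegOnePow
import Literature.AlgebraicGeometry.Motives.Varieties
import Literature.AlgebraicGeometry.Motives.Cycles
import Literature.AlgebraicGeometry.Motives.PreWeilCohomology
import Literature.AlgebraicGeometry.Motives.WeilCohomology
import HarnessLib

-- provenance: harness21/H21/H21/Prelude/MotiveAbstract/Lefschetz.lean @ bc02014 (interim HEAD d8f2665); M5 mechanical rewrite
/-!
# Lefschetz operators (trunk MotiveAbstract, prelude C10)

Vocabulary of Lefschetz theory on a (pre-)Weil cohomology theory `W`, for a `k`-scheme `X`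
thought of as smooth projective of dimension `n` with a hyperplane class `η ∈ H²(X)` and Lefschetz
operator `L = (· ∪ η)`, following Kleiman, *Algebraic cycles and the Weil conjectures* (1968) §1.4
and Kleiman, *The standard conjectures* (1994) §4:

* the **primitive parts** `Pⁱ(X) = ker (Lⁿ⁻ⁱ⁺¹ : Hⁱ(X) → H²ⁿ⁻ⁱ⁺²(X))` (`i ≤ n`);
* the operator **`Λ`**, characterised on the Lefschetz decomposition by `Λ x = 0` and
  `Λ (Lʲ⁺¹ x) = Lʲ x` for `x ∈ Pⁱ(X)` primitive and `0 ≤ j`, `i + j + 1 ≤ n`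
  (Kleiman 1968 1.4.2, 1994 §4);
* Kleiman's **Hodge-star-like involution `⋆`**, `⋆ (Lʲ x) = (-1)^{i(i+1)/2} Lⁿ⁻ⁱ⁻ʲ x` for
  `x ∈ Pⁱ(X)`, `0 ≤ j ≤ n - i` (Kleiman 1968 1.4.2; so that `Λ = ⋆ L ⋆`);
* the operators **`θ`**, two-sided inverses of the hard-Lefschetz isomorphisms
  `Lⁿ⁻ⁱ : Hⁱ(X) → H²ⁿ⁻ⁱ(X)` (Kleiman 1968 §2, conjecture `B(X)` in "θ-form");
* the **Künneth (degree) projectors** `πⁱ : H•(X) → Hⁱ(X) ↪ H•(X)` as graded operators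
  (Kleiman 1968 §1.4, §2, conjecture `C(X)`).

and the classical consequences of the hard Lefschetz property for a `W : WeilCohomology k K`
(existence and uniqueness of `Λ`, `⋆`, `θ`, the Lefschetz decomposition
`Hⁱ(X) = ⨁_{a+2b=i} Lᵇ Pᵃ(X)` and the dimension formula `dim Pⁱ = bᵢ - bᵢ₋₂`), stated with
`sorry` proofs.

## Main definitions (`W : PreWeilCohomology k K`, in `namespace Literature.PreWeilCohomology`)

* `W.primitivePart X η i r j h = ker (Lʳ : Hⁱ(X) → Hʲ(X))`, `i + 2r = j` (the primitive part
  `Pⁱ(X)` is the case `i + r = n + 1`);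
* `W.IsPrimitive n X η x`, `W.primitiveSubmodule n X η i` : primitivity of `x ∈ Hⁱ(X)` relative
  to the dimension `n` (`Pⁱ = 0` for `i > n`);
* `W.IsLambdaOp n X η Λ`, `W.IsLefschetzStar n X η S`, `W.IsLefschetzTheta n X η r h θ`,
  `W.IsDegreeProjector X i P` : relational characterisations of `Λ`, `⋆`, `θ`, `πⁱ`.

## Main statements (`W : WeilCohomology k K`, `W.HasHardLefschetz`, in `namespace Literature.WeilCohomology`)

* `existsUnique_isLambdaOp`, `existsUnique_isLefschetzStar`, `exists_isLefschetzTheta`,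
  `lefschetz_decomposition`, `finrank_primitivePart`.

## Design choices

* As in `Literature.Prelude.MotiveAbstract.PreWeilCohomology`, degrees are natural numbers and all
  degree bookkeeping is by explicit equations (`h : i + 2 * r = j`), never `ℕ`-subtraction; in
  particular the operators `Λ`, `⋆`, `θ`, `πⁱ` are introduced *relationally* (predicates on
  `W.GradedOp X X` / on linear maps) rather than constructed, since their construction needs the
  Lefschetz decomposition, which is a theorem.
* `IsPrimitive n X η x` for `x ∈ Hⁱ(X)` demands `x = 0` when `n < i` (Kleiman defines `Pⁱ` only
  for `i ≤ n`; with `Pⁱ = 0` for `i > n` the characterisations of `Λ` and `⋆` are not vacuous in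
  high degrees).
* Sign convention for `⋆`: Kleiman 1968 1.4.2 / 1994 §4, `⋆ Lʲ x = (-1)^{i(i+1)/2} Lⁿ⁻ⁱ⁻ʲ x` for
  `x ∈ Pⁱ`; the exponent `i(i+1)/2` is written with (exact) natural-number division and the sign
  as `Int.negOnePow`.
* Mathlib has no Lefschetz/primitive-cohomology vocabulary (searched `Lefschetz`, `primitive`,
  `HardLefschetz` in Mathlib: only the model-theoretic Lefschetz principle). We use Mathlib's
  `LinearMap.ker`, `Submodule.map`, `DirectSum.IsInternal`, `Module.finrank`, `Int.negOnePow`.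

## References

* S. Kleiman, *Algebraic cycles and the Weil conjectures*, in: Dix exposés sur la cohomologie des
  schémas (1968), §1.4 (1.4.1–1.4.2), §2.
* S. Kleiman, *The standard conjectures*, in: Motives (Seattle 1991), Proc. Sympos. Pure Math. 55
  (1994), §4.
* A. Grothendieck, *Standard conjectures on algebraic cycles* (1969).
-/

universe u v

open CategoryTheory AlgebraicGeometry
open scoped DirectSum

noncomputable section

namespace Literature.AlgebraicGeometry.Motives

namespace PreWeilCohomology

variable {k : Type u} [Field k] {K : Type v} [Field K] (W : PreWeilCohomology k K)
variable (X : SchemeOver k)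

/-! ## Primitive classes -/

/-- The kernel of the iterated Lefschetz operator `Lʳ = (· ∪ ηʳ) : Hⁱ(X) → Hʲ(X)`, `i + 2r = j`.
For `X` of dimension `n` and `i + r = n + 1` (so `i ≤ n + 1`) this is the **primitive part**
`Pⁱ(X) = ker (Lⁿ⁻ⁱ⁺¹ : Hⁱ(X) → H²ⁿ⁻ⁱ⁺²(X))` (Kleiman 1968 §1.4, 1.4.1; Kleiman 1994 §4). [cite: Kleiman1968, §1.4 (1.4.1)] -/
def primitivePart (η : W.obj X 2) (i r j : ℕ) (h : i + 2 * r = j) : Submodule K (W.obj X i) :=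
  LinearMap.ker (W.lefschetzPow X η r i j h)

/-- `x ∈ primitivePart ↔ Lʳ x = 0`. [folklore] -/
@[simp]
lemma mem_primitivePart (η : W.obj X 2) {i r j : ℕ} (h : i + 2 * r = j) (x : W.obj X i) :
    x ∈ W.primitivePart X η i r j h ↔ W.lefschetzPow X η r i j h x = 0 :=
  LinearMap.mem_ker

variable {X} in
/-- A class `x ∈ Hⁱ(X)` (`X` of dimension `n`, hyperplane class `η`) *is primitive*:
`Lⁿ⁻ⁱ⁺¹ x = 0` if `i ≤ n`, and `x = 0` if `i > n` (Kleiman 1968 §1.4: `Pⁱ(X) = ker Lⁿ⁻ⁱ⁺¹` for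
`i ≤ n`, and there are no nonzero primitive classes above the middle degree). Cast-free: the
condition is imposed for every `r`, `j` with `i + r = n + 1`, `i + 2r = j`. [cite: Kleiman1968, §1.4] -/
def IsPrimitive (n : ℕ) (η : W.obj X 2) {i : ℕ} (x : W.obj X i) : Prop :=
  (n < i → x = 0) ∧ ∀ (r j : ℕ) (h : i + 2 * r = j), i + r = n + 1 → W.lefschetzPow X η r i j h x = 0

/-- The submodule `Pⁱ(X) ⊆ Hⁱ(X)` of primitive classes (`X` of dimension `n`, hyperplane class
`η`); it is `ker Lⁿ⁻ⁱ⁺¹` for `i ≤ n` and `0` for `i > n` (Kleiman 1968 §1.4). [cite: Kleiman1968, §1.4] -/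
def primitiveSubmodule (n : ℕ) (η : W.obj X 2) (i : ℕ) : Submodule K (W.obj X i) where
  carrier := {x | W.IsPrimitive n η x}
  zero_mem' := ⟨fun _ ↦ rfl, fun r j h _ ↦ LinearMap.map_zero _⟩
  add_mem' {x y} hx hy :=
    ⟨fun hi ↦ by rw [hx.1 hi, hy.1 hi, add_zero],
      fun r j h hr ↦ by rw [LinearMap.map_add, hx.2 r j h hr, hy.2 r j h hr, add_zero]⟩
  smul_mem' c {x} hx :=
    ⟨fun hi ↦ by rw [hx.1 hi, smul_zero],
      fun r j h hr ↦ by rw [LinearMap.map_smul, hx.2 r j h hr, smul_zero]⟩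

/-- Membership in `primitiveSubmodule` is `IsPrimitive`. [folklore] -/
@[simp]
lemma mem_primitiveSubmodule (n : ℕ) (η : W.obj X 2) {i : ℕ} (x : W.obj X i) :
    x ∈ W.primitiveSubmodule X n η i ↔ W.IsPrimitive n η x :=
  Iff.rfl

/-- In degrees `i ≤ n` (i.e. `i + r = n + 1`), the submodule of primitive classes is the
primitive part `ker Lʳ` (Kleiman 1968 §1.4). (For `i = n + 1`, `r = 0`, the right-hand side is
`ker (· ∪ 1)`, which is `0` only under the unit axiom of `WeilCohomology`.) [cite: Kleiman1968, §1.4] -/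
lemma primitiveSubmodule_eq_primitivePart (n : ℕ) (η : W.obj X 2) {i r j : ℕ} (hi : i ≤ n)
    (hr : i + r = n + 1) (h : i + 2 * r = j) :
    W.primitiveSubmodule X n η i = W.primitivePart X η i r j h := by
  ext x
  simp only [mem_primitiveSubmodule, IsPrimitive, mem_primitivePart]
  refine ⟨fun hx ↦ hx.2 r j h hr, fun hx ↦ ⟨fun hi' ↦ absurd hi' (by omega),
    fun r' j' h' hr' ↦ ?_⟩⟩
  obtain rfl : r' = r := by omega
  obtain rfl : j' = j := by omega
  exact hx

/-! ## The operators `Λ`, `⋆`, `θ` and the degree projectors -/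

variable {X}

/-- A graded operator `Λ : H•(X) → H•(X)` *is the Lefschetz operator `Λ`* of `(X, η)`, `X` of
dimension `n` (Kleiman 1968 1.4.2, Kleiman 1994 §4): its components of degree `≠ -2` vanish, it
kills primitive classes, and `Λ (Lʳ⁺¹ x) = Lʳ x` for every primitive `x ∈ Pⁱ(X)` and every `r`
with `0 ≤ r`, `i + r + 1 ≤ n` (the range in which `Lʳ⁺¹ x` is a nonzero summand of the Lefschetz
decomposition; for `i + r + 1 > n` one has `Lʳ⁺¹ x = 0` by primitivity, so no condition may be
imposed there). Under hard Lefschetz these conditions determine `Λ` uniquely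
(`WeilCohomology.existsUnique_isLambdaOp`), and `Λ = ⋆ L ⋆`. [cite: Kleiman1968, 1.4.2] -/
def IsLambdaOp (n : ℕ) (η : W.obj X 2) (Λ : W.GradedOp X X) : Prop :=
  (∀ i j : ℕ, j + 2 ≠ i → Λ i j = 0) ∧
  (∀ (i : ℕ) (x : W.obj X i), W.IsPrimitive n η x → ∀ j : ℕ, Λ i j x = 0) ∧
  ∀ (i : ℕ) (x : W.obj X i), W.IsPrimitive n η x →
    ∀ (r j₁ j₂ : ℕ) (h₁ : i + 2 * (r + 1) = j₁) (h₂ : i + 2 * r = j₂), i + (r + 1) ≤ n →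
      Λ j₁ j₂ (W.lefschetzPow X η (r + 1) i j₁ h₁ x) = W.lefschetzPow X η r i j₂ h₂ x

/-- A graded operator `S : H•(X) → H•(X)` *is Kleiman's star operator `⋆`* of `(X, η)`, `X` of
dimension `n` (Kleiman 1968 1.4.2; Kleiman 1994 §4): its components `Hᵃ → Hᵇ` with `a + b ≠ 2n`
vanish and, for `x ∈ Pⁱ(X)` primitive and `i + j + s = n`,
`⋆ (Lʲ x) = (-1)^{i(i+1)/2} Lˢ x` (**sign convention** of Kleiman: the sign depends only on the
degree `i` of the primitive class, chosen so that `⋆² = 1` and `Λ = ⋆ L ⋆`; the exponent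
`i(i+1)/2` is an exact natural-number division). [cite: Kleiman1968, 1.4.2] -/
def IsLefschetzStar (n : ℕ) (η : W.obj X 2) (S : W.GradedOp X X) : Prop :=
  (∀ a b : ℕ, a + b ≠ 2 * n → S a b = 0) ∧
  ∀ (i : ℕ) (x : W.obj X i), W.IsPrimitive n η x →
    ∀ (j s a b : ℕ) (ha : i + 2 * j = a) (hb : i + 2 * s = b), i + j + s = n →
      S a b (W.lefschetzPow X η j i a ha x) =
        (((i * (i + 1) / 2 : ℕ) : ℤ).negOnePow : ℤ) • W.lefschetzPow X η s i b hb x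

/-- A linear map `θ : Hʲ(X) →ₗ Hⁱ(X)` *is a Lefschetz operator `θ`* for `(X, η)`, `X` of dimension
`n`, in bidegree `(j, i)` with `i + 2r = j`: `i + r = n` and `θ` is a two-sided inverse of the
hard-Lefschetz map `Lʳ = Lⁿ⁻ⁱ : Hⁱ(X) → H²ⁿ⁻ⁱ(X)` (Kleiman 1968 §2, the operator whose
algebraicity is conjecture `B(X)`; Grothendieck 1969). [cite: Kleiman1968, §2] -/
def IsLefschetzTheta (n : ℕ) (η : W.obj X 2) {i j : ℕ} (r : ℕ) (h : i + 2 * r = j)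
    (θ : W.obj X j →ₗ[K] W.obj X i) : Prop :=
  i + r = n ∧ θ ∘ₗ W.lefschetzPow X η r i j h = LinearMap.id ∧
    W.lefschetzPow X η r i j h ∘ₗ θ = LinearMap.id

variable (X) in
/-- A graded operator `P : H•(X) → H•(X)` *is the degree-`i` (Künneth) projector `πⁱ`*: its
`(i, i)` component is the identity and all other components vanish (Kleiman 1968 §1.4, §2:
algebraicity of the `πⁱ` is conjecture `C(X)`). [cite: Kleiman1968, §1.4 and §2] -/
def IsDegreeProjector (i : ℕ) (P : W.GradedOp X X) : Prop :=
  P i i = LinearMap.id ∧ ∀ a b : ℕ, ¬ (a = i ∧ b = i) → P a b = 0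

/-- The graded operator with single component `id : Hⁱ(X) → Hⁱ(X)` is the degree-`i` projector. [folklore] -/
lemma isDegreeProjector_ofLinearMap_id (i : ℕ) :
    W.IsDegreeProjector X i (GradedOp.ofLinearMap (LinearMap.id : W.obj X i →ₗ[K] W.obj X i)) :=
  ⟨GradedOp.ofLinearMap_apply_same _, fun _ _ h ↦ GradedOp.ofLinearMap_apply_of_ne _ (by tauto)⟩

/-- The degree-`i` projector is unique: `IsDegreeProjector X i P ↔ P = ofLinearMap id`. [folklore] -/
lemma isDegreeProjector_iff (i : ℕ) (P : W.GradedOp X X) :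
    W.IsDegreeProjector X i P ↔
      P = GradedOp.ofLinearMap (LinearMap.id : W.obj X i →ₗ[K] W.obj X i) := by
  refine ⟨fun hP ↦ ?_, fun hP ↦ hP ▸ W.isDegreeProjector_ofLinearMap_id i⟩
  funext a b
  by_cases hab : a = i ∧ b = i
  · obtain ⟨rfl, rfl⟩ := hab
    rw [hP.1, GradedOp.ofLinearMap_apply_same]
  · rw [hP.2 a b hab, GradedOp.ofLinearMap_apply_of_ne _ (by tauto)]

end PreWeilCohomology

/-! ## Consequences of hard Lefschetz -/

namespace WeilCohomology

variable {k : Type u} [Field k] {K : Type v} [Field K] [CharZero K] (W : WeilCohomology k K)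
variable {n : ℕ} {X : SchemeOver k} {η : W.obj X 2}

/-- **Existence and uniqueness of `Λ`** (Kleiman 1968 1.4.2; Kleiman 1994 §4): under hard
Lefschetz, for `X` smooth projective of dimension `n` and `η` a hyperplane class there is a unique
graded operator `Λ` of degree `-2` with `Λ x = 0`, `Λ Lʳ⁺¹ x = Lʳ x` for `x ∈ Pⁱ(X)` primitive and
`i + r + 1 ≤ n` (defined via the Lefschetz decomposition, whose summands `Lᵇ Pᵃ` with `a + b > n`
vanish). [cite: Kleiman1968, 1.4.2] -/
def existsUnique_isLambdaOp : Prop :=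
  ∀ (hL : W.HasHardLefschetz) (hX : IsSmoothProjective n X) (hη : W.IsHyperplaneClass X η),
    ∃! Λ : W.GradedOp X X, W.IsLambdaOp n η Λ

/-- **Existence and uniqueness of `⋆`** (Kleiman 1968 1.4.2; Kleiman 1994 §4): under hard
Lefschetz, for `X` smooth projective of dimension `n` and `η` a hyperplane class there is a unique
graded operator `⋆` with `⋆ (Lʲ x) = (-1)^{i(i+1)/2} Lⁿ⁻ⁱ⁻ʲ x` for `x ∈ Pⁱ(X)` and vanishing
off total degree `2n`. [cite: Kleiman1968, 1.4.2] -/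
def existsUnique_isLefschetzStar : Prop :=
  ∀ (hL : W.HasHardLefschetz) (hX : IsSmoothProjective n X) (hη : W.IsHyperplaneClass X η),
    ∃! S : W.GradedOp X X, W.IsLefschetzStar n η S

/-- **Existence of `θ`** (Kleiman 1968 §1.4, §2): under hard Lefschetz, `Lⁿ⁻ⁱ : Hⁱ(X) → H²ⁿ⁻ⁱ(X)`
has a two-sided linear inverse `θ` (`i + r = n`, `i + 2r = j`). [cite: Kleiman1968, §1.4 and §2] -/
theorem exists_isLefschetzTheta (hL : W.HasHardLefschetz) (hX : IsSmoothProjective n X)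
    (hη : W.IsHyperplaneClass X η) {i r j : ℕ} (hr : i + r = n) (h : i + 2 * r = j) :
    ∃ θ : W.obj X j →ₗ[K] W.obj X i, W.IsLefschetzTheta n η r h θ := by
  let e := LinearEquiv.ofBijective (W.lefschetzPow X η r i j h) (hL hX η hη i r j hr h)
  refine ⟨e.symm.toLinearMap, hr, ?_, ?_⟩
  · ext x
    exact e.symm_apply_apply x
  · ext y
    exact e.apply_symm_apply y

/-- **Lefschetz decomposition** (Kleiman 1968 1.4.1; Kleiman 1994 §4): under hard Lefschetz, for
`X` smooth projective of dimension `n` and `η` a hyperplane class,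
`Hⁱ(X) = ⨁_{a + 2b = i} Lᵇ Pᵃ(X)` (an internal direct sum; the summands with `a > n` are zero). [cite: Kleiman1968, 1.4.1] -/
def lefschetz_decomposition : Prop :=
  ∀ (hL : W.HasHardLefschetz) (hX : IsSmoothProjective n X) (hη : W.IsHyperplaneClass X η) (i : ℕ),
    DirectSum.IsInternal fun p : {p : ℕ × ℕ // p.1 + 2 * p.2 = i} ↦
      (W.primitiveSubmodule X n η p.1.1).map (W.lefschetzPow X η p.1.2 p.1.1 i p.2)

/-- **Dimension of the primitive part** (Kleiman 1968 §1.4, from 1.4.1): under hard Lefschetz,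
`dim Pⁱ⁺²(X) + dim Hⁱ(X) = dim Hⁱ⁺²(X)` for `i + 2 ≤ n` (i.e. `dim Pⁱ = bᵢ - bᵢ₋₂`), stated
additively; here `i + 2 = i'`, `i' + r = n + 1`, `i' + 2r = j` and `Pⁱ' = ker (Lʳ : Hⁱ' → Hʲ)`.
(For `r = 0`, `i' = n + 1`, both sides equal `b_{n+1} = b_{n-1}` by Poincaré duality.) [cite: Kleiman1968, §1.4 (1.4.1)] -/
def finrank_primitivePart : Prop :=
  ∀ (hL : W.HasHardLefschetz) (hX : IsSmoothProjective n X) (hη : W.IsHyperplaneClass X η) {i i' r j : ℕ} (hi : i + 2 = i') (hr : i' + r = n + 1) (h : i' + 2 * r = j),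
    Module.finrank K (W.primitivePart X η i' r j h) + Module.finrank K (W.obj X i) =
      Module.finrank K (W.obj X i')

/-- In the lowest degrees every class is primitive: `P⁰(X) = H⁰(X)` and `P¹(X) = H¹(X)`, i.e.
`Lⁿ⁺¹ : H⁰ → H²ⁿ⁺²` and `Lⁿ : H¹ → H²ⁿ⁺¹` vanish since `Hᵐ(X) = 0` for `m > 2n`
(Kleiman 1968 §1.4). Here `i ≤ 1`, `i + r = n + 1`, `i + 2r = j`. [cite: Kleiman1968, §1.4] -/
theorem primitivePart_eq_top_of_le_one (hX : IsSmoothProjective n X) (η : W.obj X 2) {i r j : ℕ}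
    (hi : i ≤ 1)
    (hr : i + r = n + 1) (h : i + 2 * r = j) : W.primitivePart X η i r j h = ⊤ := by
  haveI := W.subsingleton_obj hX (i := j) (by omega)
  rw [eq_top_iff]
  intro x _
  rw [PreWeilCohomology.mem_primitivePart]
  exact Subsingleton.elim _ _

end WeilCohomology

end Literature.AlgebraicGeometry.Motives

end
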